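import Literature.Analysis.FluidPDE.TotalDissipatorAnomalousRegularization
import Literature.Analysis.FluidPDE.UniversalTotalAnomalousDissipatorProofs
import HarnessLib

/-!
# Hess-Childs–Rowan (2025), Theorems 1.1 / 1.5 / 1.7 — proved projections and bookkeeping

Companion of `TotalDissipatorAnomalousRegularization.lean` (E. Hess-Childs, K. Rowan, *Turbulent and
intermittent phenomena in a universal total anomalous dissipator*, arXiv:2508.00115 (2025)
[cite: HessChildsRowan2025b]): theorems only, no new facts.

* `HessChildsRowan2025b_thm11`, `HessChildsRowan2025b_thm15`, `HessChildsRowan2025b_thm17`: the three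
  printed theorems as projections of the one-field fact `HessChildsRowan2025b_thm11_thm15_thm17`.
* API of `HessChildsRowan2025b.IsCarrier` (`exists_const`; `exists_isCarrier` non-vacuity;
  `HessChildsRowan2025a.IsCarrier.isCarrier_b` — the arXiv:2501.18526 carrier class, which also
  records time regularity and the pause `V = 0` on `t ≤ 1/2`, is contained in this one).
* `HessChildsRowan2025b.IsSpatiallyIntermittent.exists_large`: the divergence clause in "witness"
  form — past any threshold `M`, some diffusivity `κ ∈ (0,1)` makes every (`L²`-continuous) solution's
  `Ḣ^β` seminorm at time `t` exceed `M`.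
-/

noncomputable section

namespace Literature.Analysis.FluidPDE

open _root_.MeasureTheory _root_.Set _root_.Filter
open scoped NNReal ENNReal Topology

namespace HessChildsRowan2025b

variable {α : ℝ≥0} {V : ℝ → UnitAddTorus (Fin 2) → EuclideanSpace ℝ (Fin 2)}

/-- A carrier is bounded and `α`-Hölder in space with one constant at every time
(`V ∈ L^∞([0,1], C^α(T²))`). [cite: HessChildsRowan2025b, Lemma 2.6 p. 14] -/
theorem IsCarrier.exists_const (h : IsCarrier α V) :
    ∃ A : ℝ≥0, (∀ (t : ℝ) (x : UnitAddTorus (Fin 2)), ‖V t x‖ ≤ A) ∧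
      ∀ t : ℝ, HolderWith A α (V t) :=
  h.2.1

/-- The carrier class of the companion paper arXiv:2501.18526 (`HessChildsRowan2025a.IsCarrier`:
additionally Hölder in time and vanishing for `t ≤ 1/2`) is contained in this one. [cite: HessChildsRowan2025b, Lemma 2.6 p. 14; HessChildsRowan2025a, Lemma 2.12 p. 12] -/
theorem _root_.Literature.Analysis.FluidPDE.HessChildsRowan2025a.IsCarrier.isCarrier_b
    (h : HessChildsRowan2025a.IsCarrier α V) : IsCarrier α V := by
  obtain ⟨hm, ⟨A, hb, hH, -⟩, hdiv, -⟩ := h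
  exact ⟨hm, ⟨A, hb, hH⟩, hdiv⟩

/-- The carrier class is non-empty for every exponent (the zero field, via the arXiv:2501.18526
class and `HessChildsRowan2025a.isCarrier_zero`); the content of the theorems is in the other
clauses. [cite: HessChildsRowan2025b, Lemma 2.6 p. 14] -/
theorem exists_isCarrier (α : ℝ≥0) :
    ∃ V : ℝ → UnitAddTorus (Fin 2) → EuclideanSpace ℝ (Fin 2), IsCarrier α V :=
  ⟨fun _ _ => 0, (HessChildsRowan2025a.isCarrier_zero α).isCarrier_b⟩

/-- **Witness form of the divergence in Theorem 1.7 (case `p = 2`)**: for a nonzero mean-zero `L²`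
datum, a time `t ∈ (0, t_*)`, an exponent `β ∈ (1/2,1)` and any threshold `M`, there is a
diffusivity `κ ∈ (0,1)` at which every `L²`-continuous weak solution has `‖θ(t)‖_{Ḣ^β} ≥ M`. [cite: HessChildsRowan2025b, Thm. 1.7 p. 3] -/
theorem IsSpatiallyIntermittent.exists_large (h : IsSpatiallyIntermittent V)
    {θ₀ : UnitAddTorus (Fin 2) → ℝ} (hθ₀ : MemLp θ₀ 2 volume) (hmean : ∫ x, θ₀ x = 0)
    (hne : ¬ θ₀ =ᵐ[volume] 0) :
    ∃ tStar : ℝ, 0 < tStar ∧ tStar ≤ 1 ∧ ∀ t ∈ Ioo 0 tStar, ∀ β : ℝ, 1 / 2 < β → β < 1 →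
      ∀ M : ℝ≥0, ∃ κ : ℝ, 0 < κ ∧ κ < 1 ∧ ∀ θ : ℝ → UnitAddTorus (Fin 2) → ℝ,
        Torus.IsWeakScalarTransportDiagOn 1 ![2⁻¹, 1] κ V θ₀ θ →
        Torus.IsL2ContinuousOn (Icc 0 1) θ →
          (M : ℝ≥0∞) ≤ FunctionSpaces.Torus.eHomSobolevSeminorm β (fun x => (θ t x : ℂ)) := by
  obtain ⟨tStar, ht0, ht1, H⟩ := h θ₀ hθ₀ hmean hne
  refine ⟨tStar, ht0, ht1, fun t ht β hβ hβ1 M => ?_⟩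
  obtain ⟨κ₀, hκ₀, hκ₀1, Hκ⟩ := H t ht β hβ hβ1 M
  refine ⟨κ₀ / 2, by positivity, by linarith, fun θ hsol hcont => ?_⟩
  exact (Hκ (κ₀ / 2) ⟨by positivity, by linarith⟩ θ hsol hcont).1

end HessChildsRowan2025b

/-- **Hess-Childs–Rowan 2025, Theorem 1.1 (anomalous total dissipation)** as a projection of the
one-field fact: for every `α ∈ (0,1)` a divergence-free `V ∈ L^∞([0,1], C^α(T²))` with
`‖θ^κ(1)‖_{L¹} ≤ C κ^{(1-α)²/12} ‖θ₀‖_{L¹}` for all `κ ∈ (0,1)` and all mean-zero `L²` data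
(`HessChildsRowan2025b.DissipatesTotally`). [cite: HessChildsRowan2025b, Thm. 1.1 pp. 1–2] -/
theorem HessChildsRowan2025b_thm11 (h : HessChildsRowan2025b_thm11_thm15_thm17) :
    ∀ α : ℝ≥0, 0 < α → α < 1 →
      ∃ V : ℝ → UnitAddTorus (Fin 2) → EuclideanSpace ℝ (Fin 2),
        HessChildsRowan2025b.IsCarrier α V ∧ HessChildsRowan2025b.DissipatesTotally α V := by
  obtain ⟨γ, -, -, H⟩ := h
  intro α h0 h1
  obtain ⟨V, hV, hD, -, -⟩ := H α h0 h1
  exact ⟨V, hV, hD⟩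

/-- **Hess-Childs–Rowan 2025, Theorem 1.5 (anomalous regularization)** as a projection of the
one-field fact: there is `γ ∈ (0,1/2)` such that for every `α ∈ (0,1)` a divergence-free
`V ∈ L^∞([0,1], C^α(T²))` has `‖θ^κ‖_{L²([0,1],Ḣ^{(1-α)²γ})} ≤ C‖θ₀‖_{L²}` uniformly in `κ ∈ (0,1)`
for all mean-zero `L²` data (`HessChildsRowan2025b.RegularizesAnomalously`). [cite: HessChildsRowan2025b, Thm. 1.5 p. 2] -/
theorem HessChildsRowan2025b_thm15 (h : HessChildsRowan2025b_thm11_thm15_thm17) :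
    ∃ γ : ℝ, 0 < γ ∧ γ < 1 / 2 ∧ ∀ α : ℝ≥0, 0 < α → α < 1 →
      ∃ V : ℝ → UnitAddTorus (Fin 2) → EuclideanSpace ℝ (Fin 2),
        HessChildsRowan2025b.IsCarrier α V ∧ HessChildsRowan2025b.RegularizesAnomalously γ α V := by
  obtain ⟨γ, hγ0, hγ1, H⟩ := h
  refine ⟨γ, hγ0, hγ1, fun α h0 h1 => ?_⟩
  obtain ⟨V, hV, -, hR, -⟩ := H α h0 h1
  exact ⟨V, hV, hR⟩

/-- **Hess-Childs–Rowan 2025, Theorem 1.7 (intermittent regularity, case `p = 2`)** as a projection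
of the one-field fact: for every `α ∈ (0,1)` a divergence-free `V ∈ L^∞([0,1], C^α(T²))` for which
every nonzero mean-zero `L²` datum has `‖θ^κ(t)‖_{Ḣ^β} → ∞` (`κ → 0`) for all `t ∈ (0,t_*)`,
`β ∈ (1/2,1)` (`HessChildsRowan2025b.IsSpatiallyIntermittent`). [cite: HessChildsRowan2025b, Thm. 1.7 p. 3] -/
theorem HessChildsRowan2025b_thm17 (h : HessChildsRowan2025b_thm11_thm15_thm17) :
    ∀ α : ℝ≥0, 0 < α → α < 1 →
      ∃ V : ℝ → UnitAddTorus (Fin 2) → EuclideanSpace ℝ (Fin 2),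
        HessChildsRowan2025b.IsCarrier α V ∧ HessChildsRowan2025b.IsSpatiallyIntermittent V := by
  obtain ⟨γ, -, -, H⟩ := h
  intro α h0 h1
  obtain ⟨V, hV, -, -, hI⟩ := H α h0 h1
  exact ⟨V, hV, hI⟩

/-- Anomalous regularization and spatial intermittency coexist for the SAME field and the same
data (Thm. 1.5 with Thm. 1.7: `‖θ^κ‖_{L²_t Ḣ^{(1-α)²γ}}` stays bounded while `‖θ^κ(t)‖_{Ḣ^β} → ∞`
for `β > 1/2`), as a projection of the one-field fact. [cite: HessChildsRowan2025b, Thm. 1.5 p. 2; Thm. 1.7 p. 3; §1.1.5 p. 8] -/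
theorem HessChildsRowan2025b_thm15_thm17 (h : HessChildsRowan2025b_thm11_thm15_thm17) :
    ∃ γ : ℝ, 0 < γ ∧ γ < 1 / 2 ∧ ∀ α : ℝ≥0, 0 < α → α < 1 →
      ∃ V : ℝ → UnitAddTorus (Fin 2) → EuclideanSpace ℝ (Fin 2),
        HessChildsRowan2025b.IsCarrier α V ∧ HessChildsRowan2025b.RegularizesAnomalously γ α V ∧
          HessChildsRowan2025b.IsSpatiallyIntermittent V := by
  obtain ⟨γ, hγ0, hγ1, H⟩ := h
  refine ⟨γ, hγ0, hγ1, fun α h0 h1 => ?_⟩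
  obtain ⟨V, hV, -, hR, hI⟩ := H α h0 h1
  exact ⟨V, hV, hR, hI⟩

end Literature.Analysis.FluidPDE

end
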